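import Literature.Topology.FourManifolds.SuspendedFamilyCriticalImage
import HarnessLib

/-!
# Lekili's merging move: the critical set and the cusps of its base diagram

Topic `Literature/Topology/FourManifolds`.  The merging family
`F_s(t, x, y, z) = (t, x³ + 3(s - t²) x + y² - z²)` (`mergeMap s`,
`WrinkledFibrationMoveModels.lean`) has critical set `{x² = t² - s, y = z = 0}`.  Lekili 2009,
§3, Move 2: *"for `s<0`, `F_s` is isotopic to `F`, with the critical value set being
`C = {(t,u) : 4(t²-s)³ = u²}`. For `s<0`, `C` consists of two simple curves … For `s>0`, we get
a wrinkled map with critical value set, including two cusp singularities"*.  This file PROVES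
the model-level content of that description (no named fact):

* `s < 0` (**before the merge: two fold arcs**): the critical set is the union of the two graphs
  `x = ±√(t² - s)` over the `t`-axis (`mergeArc`, `not_surjective_fderiv_mergeMap_iff_of_neg`),
  and along each of them the critical image `v ↦ F_s(v, ±√(v² - s), 0, 0)` moves with velocity of
  first component `1` — it is immersed, there is no cusp (`merge_arc_image_velocity_ne_zero`);
* `s > 0` (**after the merge: two cusps**): the critical set is the union of the two graphs
  `t = ±√(x² + s)` over the `x`-axis (`mergeBranch`, `not_surjective_fderiv_mergeMap_iff_of_pos`),
  and on each branch the velocity of the critical image vanishes exactly at `x = 0`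
  (`merge_branch_image_deriv_eq_zero_iff`): one cusp on each branch, at `(t, x) = (±√s, 0)`.

## References

* Y. Lekili, *Wrinkled fibrations on near-symplectic manifolds*, Geom. Topol. 13 (2009)
  277–318 (arXiv:0712.2202), §3, Move 2. [Lekili2009]
* R. İ. Baykur, O. Saeki, *Simplifying indefinite fibrations on 4-manifolds*, arXiv:1705.11169,
  §3.1 (fold merge / cusp merge). [BaykurSaeki2017]
-/

noncomputable section

open scoped ContDiff
open Set Function

namespace Literature.Topology.FourManifolds

/-- Local notation: `𝔼 n` is the model Euclidean space `EuclideanSpace ℝ (Fin n)`. -/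
local notation "𝔼 " n:arg => EuclideanSpace ℝ (Fin n)

/-! ### After the merge (`s > 0`): two branches over the `x`-axis, one cusp on each -/

/-- The branch `u ↦ (ε √(u² + s), u, 0, 0)` (`ε = ±1`) of the critical set of the merging
family for `s > 0`. [folklore] -/
def mergeBranch (s ε : ℝ) : ℝ → 𝔼 4 :=
  suspendedCurve fun u => ε * Real.sqrt (u ^ 2 + s)

/-- **The critical set of the merging family for `s > 0` is the union of the two branches
`t = ±√(x² + s)`.** [cite: Lekili2009, §3 Move 2] -/
theorem not_surjective_fderiv_mergeMap_iff_of_pos {s : ℝ} (hs : 0 < s) (x : 𝔼 4) :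
    ¬ Surjective (fderiv ℝ (mergeMap s) x) ↔
      ∃ u, x = mergeBranch s 1 u ∨ x = mergeBranch s (-1) u := by
  rw [surjective_fderiv_mergeMap_iff, not_not]
  have hsq : ∀ u : ℝ, Real.sqrt (u ^ 2 + s) ^ 2 = u ^ 2 + s := fun u =>
    Real.sq_sqrt (by positivity)
  constructor
  · rintro ⟨h1, h2, h3⟩
    refine ⟨x 1, ?_⟩
    have ht : x 0 ^ 2 = Real.sqrt (x 1 ^ 2 + s) ^ 2 := by rw [hsq]; linarith
    rcases sq_eq_sq_iff_eq_or_eq_neg.mp ht with h | h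
    · left
      ext i
      fin_cases i
      · simpa [mergeBranch] using h
      · simp [mergeBranch]
      · simpa [mergeBranch] using h2
      · simpa [mergeBranch] using h3
    · right
      ext i
      fin_cases i
      · simpa [mergeBranch] using h
      · simp [mergeBranch]
      · simpa [mergeBranch] using h2
      · simpa [mergeBranch] using h3
  · rintro ⟨u, h | h⟩ <;> subst h <;> refine ⟨?_, by simp [mergeBranch], by simp [mergeBranch]⟩
    · simp [mergeBranch, hsq]
    · simp [mergeBranch, hsq]

/-- **Velocity of the critical image on a branch** (`s > 0`, `ε² = 1`):
`(ε u / √(u² + s)) • (1, ∂ₜ g)` with `∂ₜ g = -6 t x`. [folklore] -/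
theorem hasDerivAt_merge_branch_image {s ε : ℝ} (hs : 0 < s) (hε : ε ^ 2 = 1) (u : ℝ) :
    HasDerivAt (fun u => mergeMap s (mergeBranch s ε u))
      ((ε * (2 * u / (2 * Real.sqrt (u ^ 2 + s)))) •
        (EuclideanSpace.single (0 : Fin 2) (1 : ℝ) +
          (-(6 * (ε * Real.sqrt (u ^ 2 + s)) * u)) • EuclideanSpace.single (1 : Fin 2) (1 : ℝ)))
      u := by
  have hpos : u ^ 2 + s ≠ 0 := by positivity
  have hsq : Real.sqrt (u ^ 2 + s) ^ 2 = u ^ 2 + s := Real.sq_sqrt (by positivity)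
  have hτ : HasDerivAt (fun u : ℝ => ε * Real.sqrt (u ^ 2 + s))
      (ε * (2 * u / (2 * Real.sqrt (u ^ 2 + s)))) u := by
    have h1 : HasDerivAt (fun u : ℝ => u ^ 2 + s) (2 * u) u := by
      simpa using (hasDerivAt_pow 2 u).add_const s
    exact (h1.sqrt hpos).const_mul ε
  obtain ⟨g', hg, h01, h10⟩ : ∃ g' : ℝ × ℝ →L[ℝ] ℝ,
      HasFDerivAt (fun p : ℝ × ℝ => p.2 ^ 3 + 3 * (s - p.1 ^ 2) * p.2) g'
          (ε * Real.sqrt (u ^ 2 + s), u) ∧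
        g' (0, 1) = 0 ∧ g' (1, 0) = -(6 * (ε * Real.sqrt (u ^ 2 + s)) * u) :=
    ⟨_, (hasFDerivAt_snd.pow 3).add
      ((((hasFDerivAt_fst.pow 2).const_sub s).const_mul 3).mul hasFDerivAt_snd), by
        simp
        rw [mul_pow, hε, hsq]
        ring, by
        simp
        ring⟩
  have h := hasDerivAt_suspendedImage (g := fun p : ℝ × ℝ => p.2 ^ 3 + 3 * (s - p.1 ^ 2) * p.2)
    hτ hg h01
  rw [h10] at h
  exact h

/-- **One cusp on each branch after the merge**: for `s > 0` the velocity of the critical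
image along the branch `t = ε √(x² + s)` (`ε = ±1`) vanishes iff `x = 0`, i.e. exactly at the
point `(t, x) = (ε √s, 0)` — the *"two cusp singularities"* of Lekili 2009, §3, Move 2.
[cite: Lekili2009, §3 Move 2] -/
theorem merge_branch_image_deriv_eq_zero_iff {s ε : ℝ} (hs : 0 < s) (hε : ε ^ 2 = 1) (u : ℝ) :
    deriv (fun u => mergeMap s (mergeBranch s ε u)) u = 0 ↔ u = 0 := by
  rw [(hasDerivAt_merge_branch_image hs hε u).deriv, suspendedImage_deriv_eq_zero_iff]
  have hε0 : ε ≠ 0 := by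
    rintro rfl
    norm_num at hε
  have hr : 0 < Real.sqrt (u ^ 2 + s) := Real.sqrt_pos.mpr (by positivity)
  constructor
  · intro h
    have h' : 2 * u / (2 * Real.sqrt (u ^ 2 + s)) = 0 := by
      rcases mul_eq_zero.mp h with h | h
      · exact absurd h hε0
      · exact h
    rw [div_eq_zero_iff] at h'
    rcases h' with h' | h'
    · linarith
    · linarith
  · rintro rfl
    simp

/-! ### Before the merge (`s < 0`): two fold arcs over the `t`-axis, no cusp -/

/-- The arc `v ↦ (v, ε √(v² - s), 0, 0)` (`ε = ±1`) of the critical set of the merging family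
for `s < 0`. [folklore] -/
def mergeArc (s ε : ℝ) (v : ℝ) : 𝔼 4 :=
  WithLp.toLp 2 ![v, ε * Real.sqrt (v ^ 2 - s), 0, 0]

/-- Coordinates of `mergeArc`. [folklore] -/
@[simp] theorem mergeArc_apply_zero (s ε v : ℝ) : mergeArc s ε v 0 = v := by simp [mergeArc]

/-- Coordinates of `mergeArc`. [folklore] -/
@[simp] theorem mergeArc_apply_one (s ε v : ℝ) :
    mergeArc s ε v 1 = ε * Real.sqrt (v ^ 2 - s) := by
  simp [mergeArc]

/-- Coordinates of `mergeArc`. [folklore] -/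
@[simp] theorem mergeArc_apply_two (s ε v : ℝ) : mergeArc s ε v 2 = 0 := by simp [mergeArc]

/-- Coordinates of `mergeArc`. [folklore] -/
@[simp] theorem mergeArc_apply_three (s ε v : ℝ) : mergeArc s ε v 3 = 0 := by simp [mergeArc]

/-- **The critical set of the merging family for `s < 0` is the union of the two arcs
`x = ±√(t² - s)`** (graphs over the whole `t`-axis: `t² - s > 0`).
[cite: Lekili2009, §3 Move 2] -/
theorem not_surjective_fderiv_mergeMap_iff_of_neg {s : ℝ} (hs : s < 0) (x : 𝔼 4) :
    ¬ Surjective (fderiv ℝ (mergeMap s) x) ↔ ∃ v, x = mergeArc s 1 v ∨ x = mergeArc s (-1) v := by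
  rw [surjective_fderiv_mergeMap_iff, not_not]
  have hsq : ∀ v : ℝ, Real.sqrt (v ^ 2 - s) ^ 2 = v ^ 2 - s := fun v =>
    Real.sq_sqrt (by nlinarith [sq_nonneg v])
  constructor
  · rintro ⟨h1, h2, h3⟩
    refine ⟨x 0, ?_⟩
    have hx : x 1 ^ 2 = Real.sqrt (x 0 ^ 2 - s) ^ 2 := by rw [hsq]; linarith
    rcases sq_eq_sq_iff_eq_or_eq_neg.mp hx with h | h
    · left
      ext i
      fin_cases i
      · simp
      · simpa using h
      · simpa using h2
      · simpa using h3
    · right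
      ext i
      fin_cases i
      · simp
      · simpa using h
      · simpa using h2
      · simpa using h3
  · rintro ⟨v, h | h⟩ <;> subst h <;> refine ⟨?_, by simp, by simp⟩
    · simp [hsq]
    · simp [hsq]

/-- Along an arc (`s < 0`) the first coordinate of the critical image is the parameter itself:
`F_s(v, ±√(v² - s), 0, 0)₀ = v`. [folklore] -/
@[simp] theorem mergeMap_mergeArc_apply_zero (s ε v : ℝ) : mergeMap s (mergeArc s ε v) 0 = v := by
  simp [mergeMap]

/-- **No cusp before the merge**: for `s < 0` the critical image along each arc is immersed —
any velocity vector of `v ↦ F_s(v, ±√(v² - s), 0, 0)` has first component `1`, so it is never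
zero (*"`C` consists of two simple curves"*). [cite: Lekili2009, §3 Move 2] -/
theorem merge_arc_image_velocity_ne_zero {s ε v : ℝ} {γ' : 𝔼 2}
    (hγ : HasDerivAt (fun v => mergeMap s (mergeArc s ε v)) γ' v) : γ' ≠ 0 := by
  have h0 : HasDerivAt (fun v => mergeMap s (mergeArc s ε v) 0)
      ((EuclideanSpace.proj (0 : Fin 2) : 𝔼 2 →L[ℝ] ℝ) γ') v :=
    (EuclideanSpace.proj (0 : Fin 2) : 𝔼 2 →L[ℝ] ℝ).hasFDerivAt.comp_hasDerivAt v hγ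
  have hid : HasDerivAt (fun v => mergeMap s (mergeArc s ε v) 0) 1 v := by
    simp only [mergeMap_mergeArc_apply_zero]
    exact hasDerivAt_id' v
  have h1 : γ' 0 = 1 := by simpa using h0.unique hid
  intro h
  rw [h] at h1
  simp at h1

end Literature.Topology.FourManifolds

end
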